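import Summits.QuantumFields.YangMills.Theorems.BalabanUVNodesN07TowerOscCoverBridge
import Summits.QuantumFields.YangMills.Theorems.BalabanUVNodesN07SymTauTowerStatementOfFinePlaquettes
import Summits.QuantumFields.YangMills.Theorems.BalabanUVNodesN07TowerBoxPlaquettesOfAlignedRegion
import HarnessLib

/-!
# N07 [B11] (= [15] = [Balaban1985Variational]) Sect. F ∕ [I] (0.1)–(0.11) ∕ [3] (78), (167) — **THE JUNCTION's (σ2) SUPPLIER IN ONE CALL**: fine box plaquettes on the torus ⇒ the `ℤᵈ`
# cell lemma's `hptτ` row (and the cell's cross-term bound with the `τ`-side discharged) for the lifted `τ = ιSU ∘ (g₁·g₂⁻¹) ∘ π ∘ (· + c_k·𝟙)`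

Cell `pub-ymgap`, width seat `pub-ymgap-dag-n07-w3` g13 (junction side of the K0 road; (σ2) capstone).  `--kind proof --supports stmt-QuantumFields-20541 --as helper` (K0⁷; count-neutral;
THEOREMS ONLY, 0 `def`).  [I] = [Balaban1987RG1]; [3] = [Balaban1985Averaging]; [6] = [Balaban1985RegularSpaces]; [15] = [Balaban1985Variational].  CONSUMED BY NAME: this seat's
`…N07TowerBoxPlaquettesOfAlignedRegion.{towerBoxes_of_subset_aligned, cover_anchor_mem_image_of_underZ}`, `…N07SymTauTowerStatementOfFinePlaquettes.tower_statement_geom_of_fineBoxPlaqs` (torus: ✓p755647 ∘ ✓p756047) and `…N07TowerOscCoverBridge.{hpt_lift_of_torus_tower_geom,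
lift_mem_unitaryUnits_under}` (cover + typing: ✓p756357 ∘ `coe_ιSU`), ✓p755807 `B8ExpMeanLogCrossTermCellRec.norm_uavgZ_one_mul_inv_mul_sub_one_le_of_pointwise`.

WHY.  The (σ2) chain of the junction (JUNCTION-PHI-ROAD §10) — fine box plaquettes (row (17)) → 127 → 126 → `symCd` tree defect → torus pointwise descent (`δ₂ ≡ 0` by radial axiality) →
cover transcription → `SU(N) ↪ M_N(ℂ)ˣ` → ✓p753816 ∕ ✓p755807 — is here ONE theorem: its hypotheses are the two axialities of the carriers (`M^n(U^{g₁})` `symCd`-axial, `M^n(U^{g₂})` radially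
axial, `n < k`), ONE fine plaquette letter on a set containing the box plaquettes under the tower blocks over `S`, the per-level numerics with a displayed letter schedule `a`, the geometric
schedule `8σ′(a m) ≤ (ω∕2)·θ^{k−(m+1)}`, and a cell anchor `y` (depth `j′ ≤ k`) whose fine shadow covers into `S`; its conclusion is VERBATIM the `hptτ` binder of ✓p755807 for the lift of
`τ_T := g₁·g₂⁻¹` at `(j′, y)`.  §2 then discharges the `τ`-side of ✓p755807's cell bound, leaving the `u₀`-side ((σ1)), `h ≡ R̄₀^{j′}τ(y)` and the numerics displayed.  Pure composition:
NO estimate of [I]∕[3]∕[6]∕[15] is asserted.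

WHAT IS PROVED (sorry-free; every member `F.P K` of a `T4Family`, `SU(N)`, `N ≥ 1`).
§1 ★★★ `hpt_lift_of_fineBoxPlaqs` — the `hpt`∕`hptτ` row of the lift of `g₁·g₂⁻¹` at a cell, from the torus data (`0 ≤ θ ≤ 1∕2`, `0 ≤ ω`).
§2 ★★★ `norm_uavgZ_one_lift_mul_inv_mul_sub_one_le_of_fineBoxPlaqs` — ✓p755807's cell bound `‖R̄₀^{j′}(τ·h⁻¹·u)(y) − 1‖ ≤ 1024·(4(ω_τ + ω_u))²` with the `τ`-side read from the torus
   data (`θ ≤ 1∕8`, `ω_τ + ω_u ≤ 1∕512`, `4096·θ·(ω_τ + ω_u) ≤ 1`).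
§3 ★★★ `hpt_lift_of_fineLetter_aligned` ∕ ★★★ `norm_uavgZ_one_lift_mul_inv_mul_sub_one_le_of_fineLetter_aligned` — §1∕§2 with the two geometric binders `hS₀`∕`hyS` DISCHARGED by this seat's
   `…N07TowerBoxPlaquettesOfAlignedRegion` for `S :=` the image of the cell's anchored `L^{j′}`-box: the remaining geometric data are ONE fine letter `PlaqSmallOn (plaqsOf Ω′) a₀ U`, an
   `L^k`-aligned `Y ⊆ ℤᵈ` with `π '' Y ⊆ Ω′` (the anchored lift of the collar) and «the cell's anchored box ⊆ Y».
HONEST FRAMING: count-neutral helper; two compositions — nothing of [I]∕[3]∕[6]∕[15] asserted or discharged; the fine plaquette letter, the two axialities, the numeric∕geometric schedules,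
the `u₀`-side letters ((σ1)) and `h`'s block-constancy remain DISPLAYED hypotheses of the junction's knit; `NrmSymPhiOfRecord` ∕ `HThm4RecSym152PhiE(G)` ∕ `HThm4Rec*` UNDISCHARGED; N05 ∕ N07
NOT discharged; K0⁷ ∕ K1⁹ NOT closed; counts unmoved (typed 28∕28 · discharged 8∕28); one finite 𝕋⁴ programme at fixed ε — R4 closes the conditional finite-𝕋⁴ rung `BalabanLadder.UV` only;
the YM mass gap (Clay) is NOT proved by any of this; nothing continuum ∕ ℝ⁴ ∕ OS.  No `def`, no `instance`, no `notation`, no `sorry`.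

References: [I] (0.1) p. 251, (0.3)–(0.4) pp. 252–253, (0.11) p. 253; [3] (78)–(81) p. 30, (167) p. 44; [6] (1.15) p. 78, (1.19) p. 79, (1.29) p. 81; [15] (147)–(154) pp. 301–302.
-/

set_option autoImplicit false

noncomputable section

open scoped BigOperators Matrix.Norms.L2Operator

namespace Summit.QuantumFields.YangMills.BalabanUVNodes.N07SymTauCellRowOfFinePlaquettes

open Literature.MathematicalPhysics.QuantumFieldTheory.Balaban1983to89
open Literature.MathematicalPhysics.QuantumFieldTheory.Balaban1983to89.Node00
open T4Continuum (T4Family)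
open T4AxialGaugeSmallField (castSite boxPlaqs)
open B14DomainGeom (Pt)
open GaugeField (gaugeAct)
open ExpMeanLog (deltaSU)
open BlockAveragingZd (ctrShift)
open B8Eq119TwistedAxialRec (UnderZ)
open B15Eq112TorusCover (cover)
open B5Eq118OneStroke (iterBlockOf)
open B15DeterminingSets (embIter)
open B7Prop2Explicit (unitaryUnits)
open B7SectCDGaugeAveragesRec (uavgZ)
open B8ExpMeanLogCrossTermCellRec (norm_uavgZ_one_mul_inv_mul_sub_one_le_of_pointwise)
open Summit.QuantumFields.Balaban3D.Carriers (radialContourData)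
open Summit.QuantumFields.YangMills.BalabanUVNodes.N07NormalisationSymOfRecord (symCd)
open Summit.QuantumFields.YangMills.BalabanUVNodes.N07TowerOscCoverBridge (hpt_lift_of_torus_tower_geom lift_mem_unitaryUnits_under)
open Summit.QuantumFields.YangMills.BalabanUVNodes.N07SymTauTowerStatementOfFinePlaquettes (tower_statement_geom_of_fineBoxPlaqs)
open Summit.QuantumFields.YangMills.BalabanUVNodes.N07TowerBoxPlaquettesOfAlignedRegion (towerBoxes_of_subset_aligned cover_anchor_mem_image_of_underZ)
open Literature.MathematicalPhysics.QuantumLattice (blockMap)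
open B8Eq17ClassAkV1 (plaqsOf)

variable {F : T4Family} (N : ℕ) [NeZero N]

/-! ## §1  Fine box plaquettes ⇒ the `hptτ` row of the lifted `g₁·g₂⁻¹` at a cell -/

/-- ★★★ **THE (σ2) SUPPLIER IN ONE CALL** — for an `SU(N)` field `U` on `F.P K`, carriers `g₁` (`M^n(U^{g₁})` `symCd`-axial, `n < k`) and `g₂` (`M^n(U^{g₂})` radially axial, `n < k`), a fine
site set `S`, ONE fine plaquette letter `PlaqSmallOn S₀ a₀ U` with `S₀ ⊇` the box plaquettes under every tower block over `S`, ✓p755647's per-level numerics for a displayed letter schedule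
`a`, the geometric schedule `8σ′(a m) ≤ (ω∕2)·θ^{k−(m+1)}` (`0 ≤ θ ≤ 1∕2`, `0 ≤ ω`), and a cell anchor `y` at depth `j′ ≤ k ≤ m + K` whose fine shadow covers (anchored at `c_k`) into `S`:
the lift `τ := fun x => ιSU N (g₁(π(x + c_k·𝟙))·g₂(π(x + c_k·𝟙))⁻¹)` satisfies VERBATIM the `hpt`∕`hptτ` binder of ✓p753816 ∕ ✓p755807 at `(j′, y)` with constant `ω`.
[cite: Balaban1987RG1, (0.1) p.251, (0.3)–(0.4) pp.252–253, (0.11) p.253; Balaban1985Averaging, (167) p.44; Balaban1985RegularSpaces, (1.15) p.78, (1.19) p.79; Balaban1985Variational, (147)–(154) pp.301–302] -/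
theorem hpt_lift_of_fineBoxPlaqs {K k : ℕ} (hk : k ≤ (F.P K).m + (F.P K).K) (U : GaugeField (F.P K) 0 (SU N)) (g₁ g₂ : GaugeTransf (F.P K) 0 (SU N))
    (S : Set (Site (F.P K) 0))
    (hax₁ : ∀ n, n < k → AxialGauge (symCd F N K n) (Averaging.iter (avOfRecord F N K) n (gaugeAct g₁ U)))
    (hax₂ : ∀ n, n < k → AxialGauge (radialContourData (F.P K) n (SU N)) (Averaging.iter (avOfRecord F N K) n (gaugeAct g₂ U)))
    (hN : ∀ n, n < k → (F.P K).L < (F.P K).sitesPerDir n)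
    {a₀ : ℝ} (ha₀ : 0 ≤ a₀) {S₀ : Set (Plaq (F.P K) 0)} (hU : PlaqSmallOn S₀ a₀ U)
    (hS₀ : ∀ n, n < k → ∀ w ∈ S, ∃ t : Fin (F.P K).d → ℤ, (castSite t : Site (F.P K) (n + 1)) = iterBlockOf (n + 1) w ∧
      boxPlaqs (fun i => ((F.P K).L : ℤ) ^ (n + 1) * t i) (fun i => ((F.P K).L : ℤ) ^ (n + 1) * t i + (((F.P K).L : ℤ) ^ (n + 1) - 1)) ⊆ S₀)
    (a : ℕ → ℝ) (ha : ∀ n, 0 ≤ a n)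
    (hbud : ∀ n, n < k →
      6400 * ((((F.P K).d + 2) * (F.P K).L : ℕ) : ℝ) ^ 2 * ((F.P K).L : ℝ) ^ (n + 1) * (((((F.P K).d - 1 : ℕ) : ℝ)) * ((((F.P K).L ^ (n + 1) - 1 : ℕ) : ℝ)) * a₀) ≤ 1)
    (hgd : ∀ n, n < k →
      30 * ((((F.P K).d + 2) * (F.P K).L : ℕ) : ℝ) ^ 2 * ((F.P K).L : ℝ) ^ (n + 1) * (((((F.P K).d - 1 : ℕ) : ℝ)) * ((((F.P K).L ^ (n + 1) - 1 : ℕ) : ℝ)) * a₀) < deltaSU (Fin N))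
    (haa : ∀ n, n < k →
      120 * ((((F.P K).d + 2) * (F.P K).L : ℕ) : ℝ) * ((F.P K).L : ℝ) ^ n * (((((F.P K).d - 1 : ℕ) : ℝ)) * ((((F.P K).L ^ (n + 1) - 1 : ℕ) : ℝ)) * a₀) < a n)
    (h100 : ∀ n, n < k → 2 * ((((F.P K).d * (((F.P K).L - 1) / 2) : ℕ) : ℝ) * (((((F.P K).d - 1 : ℕ) : ℝ) * (((F.P K).L - 1 : ℕ) : ℝ)) * a n)) ≤ 1 / 100)
    (hguard : ∀ n, n < k →
      2 * ((((F.P K).d * (((F.P K).L - 1) / 2) : ℕ) : ℝ) * (((((F.P K).d - 1 : ℕ) : ℝ) * (((F.P K).L - 1 : ℕ) : ℝ)) * a n)) < (FederbushMean.federbushSU (n := Fin N)).δ)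
    {ω θ : ℝ} (hθ0 : 0 ≤ θ) (hθ : θ ≤ 1 / 2) (hω0 : 0 ≤ ω)
    (hE : ∀ m, m < k → 4 * (2 * ((((F.P K).d * (((F.P K).L - 1) / 2) : ℕ) : ℝ) * (((((F.P K).d - 1 : ℕ) : ℝ) * (((F.P K).L - 1 : ℕ) : ℝ)) * a m))) ≤
      ω / 2 * θ ^ (k - (m + 1)))
    {j : ℕ} (hjk : j ≤ k) (y : Pt (F.P K).d)
    (hyS : ∀ w, UnderZ (F.P K).L j y w → cover (F.P K) (w + fun _ => ((ctrShift (F.P K).L k : ℕ) : ℤ)) ∈ S) :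
    ∀ i, i < j → ∀ z, UnderZ (F.P K).L (j - (i + 1)) y z → ∀ w, UnderZ (F.P K).L (i + 1) z w →
      ‖(((((fun x => ιSU N ((fun x' => g₁ x' * (g₂ x')⁻¹) (cover (F.P K) (x + fun _ => ((ctrShift (F.P K).L k : ℕ) : ℤ)))))
              ((((F.P K).L : ℤ) ^ (i + 1)) • z))⁻¹ *
          (fun x => ιSU N ((fun x' => g₁ x' * (g₂ x')⁻¹) (cover (F.P K) (x + fun _ => ((ctrShift (F.P K).L k : ℕ) : ℤ))))) w : (MatA N)ˣ)) : MatA N) - 1‖ ≤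
        ω * θ ^ (j - (i + 1)) :=
  hpt_lift_of_torus_tower_geom N hk (fun x' => g₁ x' * (g₂ x')⁻¹) S hθ0 (hθ.trans (by norm_num)) hω0
    (tower_statement_geom_of_fineBoxPlaqs hk U g₁ g₂ S hax₁ hax₂ hN ha₀ hU hS₀ a ha hbud hgd haa h100 hguard hθ0 hθ hω0 hE) hjk y hyS

/-! ## §2  Fine box plaquettes ⇒ the cell's cross-term bound with the `τ`-side discharged -/

/-- ★★★ **THE CELL BOUND WITH THE `τ`-SIDE READ FROM THE FINE BOX PLAQUETTES** — ✓p755807 `norm_uavgZ_one_mul_inv_mul_sub_one_le_of_pointwise` for the lift `τ` of `g₁·g₂⁻¹` with `hτ`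
and `hptτ` DISCHARGED by §1 (`θ ≤ 1∕8`): given a pre-composition `h ≡ R̄₀^{j′}τ(y)` under `y`, a unitary `u` with `R̄₀^{j′}u(y) = 1` and pointwise multiscale oscillation `ω_u·θ^{j′−(i+1)}` under
`y` (the (σ1) letters, DISPLAYED), and `ω_τ + ω_u ≤ 1∕512`, `4096·θ·(ω_τ + ω_u) ≤ 1`: `‖R̄₀^{j′}(τ·h⁻¹·u)(y) − 1‖ ≤ 1024·(4(ω_τ + ω_u))²`.
[cite: Balaban1985Averaging, (78)–(81) p.30, (167) p.44; Balaban1985RegularSpaces, (1.29) p.81; Balaban1987RG1, (0.3)–(0.4) pp.252–253, (0.11) p.253; Balaban1985Variational, (147)–(154) pp.301–302] -/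
theorem norm_uavgZ_one_lift_mul_inv_mul_sub_one_le_of_fineBoxPlaqs {K k : ℕ} (hk : k ≤ (F.P K).m + (F.P K).K) (U : GaugeField (F.P K) 0 (SU N))
    (g₁ g₂ : GaugeTransf (F.P K) 0 (SU N)) (S : Set (Site (F.P K) 0))
    (hax₁ : ∀ n, n < k → AxialGauge (symCd F N K n) (Averaging.iter (avOfRecord F N K) n (gaugeAct g₁ U)))
    (hax₂ : ∀ n, n < k → AxialGauge (radialContourData (F.P K) n (SU N)) (Averaging.iter (avOfRecord F N K) n (gaugeAct g₂ U)))
    (hN : ∀ n, n < k → (F.P K).L < (F.P K).sitesPerDir n)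
    {a₀ : ℝ} (ha₀ : 0 ≤ a₀) {S₀ : Set (Plaq (F.P K) 0)} (hU : PlaqSmallOn S₀ a₀ U)
    (hS₀ : ∀ n, n < k → ∀ w ∈ S, ∃ t : Fin (F.P K).d → ℤ, (castSite t : Site (F.P K) (n + 1)) = iterBlockOf (n + 1) w ∧
      boxPlaqs (fun i => ((F.P K).L : ℤ) ^ (n + 1) * t i) (fun i => ((F.P K).L : ℤ) ^ (n + 1) * t i + (((F.P K).L : ℤ) ^ (n + 1) - 1)) ⊆ S₀)
    (a : ℕ → ℝ) (ha : ∀ n, 0 ≤ a n)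
    (hbud : ∀ n, n < k →
      6400 * ((((F.P K).d + 2) * (F.P K).L : ℕ) : ℝ) ^ 2 * ((F.P K).L : ℝ) ^ (n + 1) * (((((F.P K).d - 1 : ℕ) : ℝ)) * ((((F.P K).L ^ (n + 1) - 1 : ℕ) : ℝ)) * a₀) ≤ 1)
    (hgd : ∀ n, n < k →
      30 * ((((F.P K).d + 2) * (F.P K).L : ℕ) : ℝ) ^ 2 * ((F.P K).L : ℝ) ^ (n + 1) * (((((F.P K).d - 1 : ℕ) : ℝ)) * ((((F.P K).L ^ (n + 1) - 1 : ℕ) : ℝ)) * a₀) < deltaSU (Fin N))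
    (haa : ∀ n, n < k →
      120 * ((((F.P K).d + 2) * (F.P K).L : ℕ) : ℝ) * ((F.P K).L : ℝ) ^ n * (((((F.P K).d - 1 : ℕ) : ℝ)) * ((((F.P K).L ^ (n + 1) - 1 : ℕ) : ℝ)) * a₀) < a n)
    (h100 : ∀ n, n < k → 2 * ((((F.P K).d * (((F.P K).L - 1) / 2) : ℕ) : ℝ) * (((((F.P K).d - 1 : ℕ) : ℝ) * (((F.P K).L - 1 : ℕ) : ℝ)) * a n)) ≤ 1 / 100)
    (hguard : ∀ n, n < k →
      2 * ((((F.P K).d * (((F.P K).L - 1) / 2) : ℕ) : ℝ) * (((((F.P K).d - 1 : ℕ) : ℝ) * (((F.P K).L - 1 : ℕ) : ℝ)) * a n)) < (FederbushMean.federbushSU (n := Fin N)).δ)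
    {ωτ ωu θ : ℝ} (hθ0 : 0 ≤ θ) (hθ : θ ≤ 1 / 8) (hωτ0 : 0 ≤ ωτ) (hωu0 : 0 ≤ ωu) (hω : ωτ + ωu ≤ 1 / 512) (hθω : 4096 * θ * (ωτ + ωu) ≤ 1)
    (hE : ∀ m, m < k → 4 * (2 * ((((F.P K).d * (((F.P K).L - 1) / 2) : ℕ) : ℝ) * (((((F.P K).d - 1 : ℕ) : ℝ) * (((F.P K).L - 1 : ℕ) : ℝ)) * a m))) ≤
      ωτ / 2 * θ ^ (k - (m + 1)))
    {j : ℕ} (hjk : j ≤ k) (y : Pt (F.P K).d)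
    (hyS : ∀ w, UnderZ (F.P K).L j y w → cover (F.P K) (w + fun _ => ((ctrShift (F.P K).L k : ℕ) : ℤ)) ∈ S)
    (h u : Pt (F.P K).d → (MatA N)ˣ)
    (hu : letI : CStarAlgebra (MatA N) := {}; ∀ x, UnderZ (F.P K).L j y x → u x ∈ unitaryUnits (MatA N))
    (hh : ∀ x, UnderZ (F.P K).L j y x →
      h x = uavgZ (F.P K).L (1 : Pt (F.P K).d → Fin (F.P K).d → (MatA N)ˣ)
        (fun x => ιSU N ((fun x' => g₁ x' * (g₂ x')⁻¹) (cover (F.P K) (x + fun _ => ((ctrShift (F.P K).L k : ℕ) : ℤ))))) j y)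
    (hptu : ∀ i, i < j → ∀ z, UnderZ (F.P K).L (j - (i + 1)) y z → ∀ w, UnderZ (F.P K).L (i + 1) z w →
      ‖((((u ((((F.P K).L : ℤ) ^ (i + 1)) • z))⁻¹ * u w : (MatA N)ˣ)) : MatA N) - 1‖ ≤ ωu * θ ^ (j - (i + 1)))
    (hu1 : uavgZ (F.P K).L (1 : Pt (F.P K).d → Fin (F.P K).d → (MatA N)ˣ) u j y = 1) :
    ‖((uavgZ (F.P K).L (1 : Pt (F.P K).d → Fin (F.P K).d → (MatA N)ˣ)
        ((fun x => ιSU N ((fun x' => g₁ x' * (g₂ x')⁻¹) (cover (F.P K) (x + fun _ => ((ctrShift (F.P K).L k : ℕ) : ℤ))))) * h⁻¹ * u) j y : (MatA N)ˣ) :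
          MatA N) - 1‖ ≤ 1024 * (4 * (ωτ + ωu)) ^ 2 := by
  letI : CStarAlgebra (MatA N) := {}
  exact norm_uavgZ_one_mul_inv_mul_sub_one_le_of_pointwise (F.P K).hL.1 _ h u j y hθ0 hθ hωτ0 hωu0 hω hθω
    (lift_mem_unitaryUnits_under N (fun x' => g₁ x' * (g₂ x')⁻¹) k j y) hu hh
    (hpt_lift_of_fineBoxPlaqs N hk U g₁ g₂ S hax₁ hax₂ hN ha₀ hU hS₀ a ha hbud hgd haa h100 hguard hθ0 (hθ.trans (by norm_num)) hωτ0 hE hjk y hyS)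
    hptu hu1

/-! ## §3  The geometric binders discharged: ONE fine letter on `plaqsOf Ω′`, an aligned collar lift `Y`, the cell's anchored box inside `Y` -/

/-- ★★★ **THE (σ2) SUPPLIER PER CELL, GEOMETRY DISCHARGED** — §1 with `S :=` the image of the cell's anchored `L^{j′}`-box `{x | ⌊x∕L^{j′}⌋ = y + c_{k−j′}·𝟙}`: the `hS₀`∕`hyS` binders are
replaced by ONE fine letter `PlaqSmallOn (plaqsOf Ω′) a₀ U` (row (17): `Sect2.omegaPlaqsTop s.Ω · (j−1) = plaqsOf Ω_{j−1}`), an `L^k`-ALIGNED `Y ⊆ ℤᵈ` with `π '' Y ⊆ Ω′` (the anchored lift of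
the collar) and «the cell's anchored box ⊆ Y».  Conclusion: VERBATIM the `hpt`∕`hptτ` binder of ✓p753816 ∕ ✓p755807 for the lift of `g₁·g₂⁻¹` at `(j′, y)`.
[cite: Balaban1987RG1, (0.1) p.251, (0.3)–(0.4) pp.252–253, (0.11) p.253; Balaban1985Averaging, (167) p.44; Balaban1985RegularSpaces, (1.7) p.77, (1.15) p.78, (1.19) p.79; Balaban1985Variational, (2) p.278, (147)–(154) pp.301–302] -/
theorem hpt_lift_of_fineLetter_aligned {K k : ℕ} (hk : k ≤ (F.P K).m + (F.P K).K) (U : GaugeField (F.P K) 0 (SU N)) (g₁ g₂ : GaugeTransf (F.P K) 0 (SU N))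
    (hax₁ : ∀ n, n < k → AxialGauge (symCd F N K n) (Averaging.iter (avOfRecord F N K) n (gaugeAct g₁ U)))
    (hax₂ : ∀ n, n < k → AxialGauge (radialContourData (F.P K) n (SU N)) (Averaging.iter (avOfRecord F N K) n (gaugeAct g₂ U)))
    (hN : ∀ n, n < k → (F.P K).L < (F.P K).sitesPerDir n)
    {a₀ : ℝ} (ha₀ : 0 ≤ a₀) {Ω' : Set (Site (F.P K) 0)} (hU : PlaqSmallOn (plaqsOf Ω') a₀ U)
    {Y : Set (Pt (F.P K).d)} (hY : ∀ x ∈ Y, ∀ z : Pt (F.P K).d, blockMap ((F.P K).L ^ k) z = blockMap ((F.P K).L ^ k) x → z ∈ Y)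
    (hYΩ : cover (F.P K) '' Y ⊆ Ω')
    (a : ℕ → ℝ) (ha : ∀ n, 0 ≤ a n)
    (hbud : ∀ n, n < k →
      6400 * ((((F.P K).d + 2) * (F.P K).L : ℕ) : ℝ) ^ 2 * ((F.P K).L : ℝ) ^ (n + 1) * (((((F.P K).d - 1 : ℕ) : ℝ)) * ((((F.P K).L ^ (n + 1) - 1 : ℕ) : ℝ)) * a₀) ≤ 1)
    (hgd : ∀ n, n < k →
      30 * ((((F.P K).d + 2) * (F.P K).L : ℕ) : ℝ) ^ 2 * ((F.P K).L : ℝ) ^ (n + 1) * (((((F.P K).d - 1 : ℕ) : ℝ)) * ((((F.P K).L ^ (n + 1) - 1 : ℕ) : ℝ)) * a₀) < deltaSU (Fin N))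
    (haa : ∀ n, n < k →
      120 * ((((F.P K).d + 2) * (F.P K).L : ℕ) : ℝ) * ((F.P K).L : ℝ) ^ n * (((((F.P K).d - 1 : ℕ) : ℝ)) * ((((F.P K).L ^ (n + 1) - 1 : ℕ) : ℝ)) * a₀) < a n)
    (h100 : ∀ n, n < k → 2 * ((((F.P K).d * (((F.P K).L - 1) / 2) : ℕ) : ℝ) * (((((F.P K).d - 1 : ℕ) : ℝ) * (((F.P K).L - 1 : ℕ) : ℝ)) * a n)) ≤ 1 / 100)
    (hguard : ∀ n, n < k →
      2 * ((((F.P K).d * (((F.P K).L - 1) / 2) : ℕ) : ℝ) * (((((F.P K).d - 1 : ℕ) : ℝ) * (((F.P K).L - 1 : ℕ) : ℝ)) * a n)) < (FederbushMean.federbushSU (n := Fin N)).δ)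
    {ω θ : ℝ} (hθ0 : 0 ≤ θ) (hθ : θ ≤ 1 / 2) (hω0 : 0 ≤ ω)
    (hE : ∀ m, m < k → 4 * (2 * ((((F.P K).d * (((F.P K).L - 1) / 2) : ℕ) : ℝ) * (((((F.P K).d - 1 : ℕ) : ℝ) * (((F.P K).L - 1 : ℕ) : ℝ)) * a m))) ≤
      ω / 2 * θ ^ (k - (m + 1)))
    {j : ℕ} (hjk : j ≤ k) (y : Pt (F.P K).d)
    (hyY : {x : Pt (F.P K).d | blockMap ((F.P K).L ^ j) x = y + fun _ => ((ctrShift (F.P K).L (k - j) : ℕ) : ℤ)} ⊆ Y) :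
    ∀ i, i < j → ∀ z, UnderZ (F.P K).L (j - (i + 1)) y z → ∀ w, UnderZ (F.P K).L (i + 1) z w →
      ‖(((((fun x => ιSU N ((fun x' => g₁ x' * (g₂ x')⁻¹) (cover (F.P K) (x + fun _ => ((ctrShift (F.P K).L k : ℕ) : ℤ)))))
              ((((F.P K).L : ℤ) ^ (i + 1)) • z))⁻¹ *
          (fun x => ιSU N ((fun x' => g₁ x' * (g₂ x')⁻¹) (cover (F.P K) (x + fun _ => ((ctrShift (F.P K).L k : ℕ) : ℤ))))) w : (MatA N)ˣ)) : MatA N) - 1‖ ≤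
        ω * θ ^ (j - (i + 1)) :=
  hpt_lift_of_fineBoxPlaqs N hk U g₁ g₂
    (cover (F.P K) '' {x : Pt (F.P K).d | blockMap ((F.P K).L ^ j) x = y + fun _ => ((ctrShift (F.P K).L (k - j) : ℕ) : ℤ)})
    hax₁ hax₂ hN ha₀ hU (towerBoxes_of_subset_aligned le_rfl hk hyY hY hYΩ) a ha hbud hgd haa h100 hguard hθ0 hθ hω0 hE hjk y
    (cover_anchor_mem_image_of_underZ hjk y (fun _ hx => hx))

/-- ★★★ **THE CELL BOUND, GEOMETRY DISCHARGED** — §2 with `S :=` the image of the cell's anchored box and the `hS₀`∕`hyS` binders replaced as in `hpt_lift_of_fineLetter_aligned`: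
`‖R̄₀^{j′}(τ·h⁻¹·u)(y) − 1‖ ≤ 1024·(4(ω_τ + ω_u))²` for the lift `τ` of `g₁·g₂⁻¹`, given the `u₀`-side letters ((σ1)), `h ≡ R̄₀^{j′}τ(y)` under `y` and the numerics (all DISPLAYED).
[cite: Balaban1985Averaging, (78)–(81) p.30, (167) p.44; Balaban1985RegularSpaces, (1.7) p.77, (1.29) p.81; Balaban1987RG1, (0.3)–(0.4) pp.252–253, (0.11) p.253; Balaban1985Variational, (147)–(154) pp.301–302] -/
theorem norm_uavgZ_one_lift_mul_inv_mul_sub_one_le_of_fineLetter_aligned {K k : ℕ} (hk : k ≤ (F.P K).m + (F.P K).K) (U : GaugeField (F.P K) 0 (SU N))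
    (g₁ g₂ : GaugeTransf (F.P K) 0 (SU N))
    (hax₁ : ∀ n, n < k → AxialGauge (symCd F N K n) (Averaging.iter (avOfRecord F N K) n (gaugeAct g₁ U)))
    (hax₂ : ∀ n, n < k → AxialGauge (radialContourData (F.P K) n (SU N)) (Averaging.iter (avOfRecord F N K) n (gaugeAct g₂ U)))
    (hN : ∀ n, n < k → (F.P K).L < (F.P K).sitesPerDir n)
    {a₀ : ℝ} (ha₀ : 0 ≤ a₀) {Ω' : Set (Site (F.P K) 0)} (hU : PlaqSmallOn (plaqsOf Ω') a₀ U)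
    {Y : Set (Pt (F.P K).d)} (hY : ∀ x ∈ Y, ∀ z : Pt (F.P K).d, blockMap ((F.P K).L ^ k) z = blockMap ((F.P K).L ^ k) x → z ∈ Y)
    (hYΩ : cover (F.P K) '' Y ⊆ Ω')
    (a : ℕ → ℝ) (ha : ∀ n, 0 ≤ a n)
    (hbud : ∀ n, n < k →
      6400 * ((((F.P K).d + 2) * (F.P K).L : ℕ) : ℝ) ^ 2 * ((F.P K).L : ℝ) ^ (n + 1) * (((((F.P K).d - 1 : ℕ) : ℝ)) * ((((F.P K).L ^ (n + 1) - 1 : ℕ) : ℝ)) * a₀) ≤ 1)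
    (hgd : ∀ n, n < k →
      30 * ((((F.P K).d + 2) * (F.P K).L : ℕ) : ℝ) ^ 2 * ((F.P K).L : ℝ) ^ (n + 1) * (((((F.P K).d - 1 : ℕ) : ℝ)) * ((((F.P K).L ^ (n + 1) - 1 : ℕ) : ℝ)) * a₀) < deltaSU (Fin N))
    (haa : ∀ n, n < k →
      120 * ((((F.P K).d + 2) * (F.P K).L : ℕ) : ℝ) * ((F.P K).L : ℝ) ^ n * (((((F.P K).d - 1 : ℕ) : ℝ)) * ((((F.P K).L ^ (n + 1) - 1 : ℕ) : ℝ)) * a₀) < a n)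
    (h100 : ∀ n, n < k → 2 * ((((F.P K).d * (((F.P K).L - 1) / 2) : ℕ) : ℝ) * (((((F.P K).d - 1 : ℕ) : ℝ) * (((F.P K).L - 1 : ℕ) : ℝ)) * a n)) ≤ 1 / 100)
    (hguard : ∀ n, n < k →
      2 * ((((F.P K).d * (((F.P K).L - 1) / 2) : ℕ) : ℝ) * (((((F.P K).d - 1 : ℕ) : ℝ) * (((F.P K).L - 1 : ℕ) : ℝ)) * a n)) < (FederbushMean.federbushSU (n := Fin N)).δ)
    {ωτ ωu θ : ℝ} (hθ0 : 0 ≤ θ) (hθ : θ ≤ 1 / 8) (hωτ0 : 0 ≤ ωτ) (hωu0 : 0 ≤ ωu) (hω : ωτ + ωu ≤ 1 / 512) (hθω : 4096 * θ * (ωτ + ωu) ≤ 1)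
    (hE : ∀ m, m < k → 4 * (2 * ((((F.P K).d * (((F.P K).L - 1) / 2) : ℕ) : ℝ) * (((((F.P K).d - 1 : ℕ) : ℝ) * (((F.P K).L - 1 : ℕ) : ℝ)) * a m))) ≤
      ωτ / 2 * θ ^ (k - (m + 1)))
    {j : ℕ} (hjk : j ≤ k) (y : Pt (F.P K).d)
    (hyY : {x : Pt (F.P K).d | blockMap ((F.P K).L ^ j) x = y + fun _ => ((ctrShift (F.P K).L (k - j) : ℕ) : ℤ)} ⊆ Y)
    (h u : Pt (F.P K).d → (MatA N)ˣ)
    (hu : letI : CStarAlgebra (MatA N) := {}; ∀ x, UnderZ (F.P K).L j y x → u x ∈ unitaryUnits (MatA N))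
    (hh : ∀ x, UnderZ (F.P K).L j y x →
      h x = uavgZ (F.P K).L (1 : Pt (F.P K).d → Fin (F.P K).d → (MatA N)ˣ)
        (fun x => ιSU N ((fun x' => g₁ x' * (g₂ x')⁻¹) (cover (F.P K) (x + fun _ => ((ctrShift (F.P K).L k : ℕ) : ℤ))))) j y)
    (hptu : ∀ i, i < j → ∀ z, UnderZ (F.P K).L (j - (i + 1)) y z → ∀ w, UnderZ (F.P K).L (i + 1) z w →
      ‖((((u ((((F.P K).L : ℤ) ^ (i + 1)) • z))⁻¹ * u w : (MatA N)ˣ)) : MatA N) - 1‖ ≤ ωu * θ ^ (j - (i + 1)))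
    (hu1 : uavgZ (F.P K).L (1 : Pt (F.P K).d → Fin (F.P K).d → (MatA N)ˣ) u j y = 1) :
    ‖((uavgZ (F.P K).L (1 : Pt (F.P K).d → Fin (F.P K).d → (MatA N)ˣ)
        ((fun x => ιSU N ((fun x' => g₁ x' * (g₂ x')⁻¹) (cover (F.P K) (x + fun _ => ((ctrShift (F.P K).L k : ℕ) : ℤ))))) * h⁻¹ * u) j y : (MatA N)ˣ) :
          MatA N) - 1‖ ≤ 1024 * (4 * (ωτ + ωu)) ^ 2 :=
  norm_uavgZ_one_lift_mul_inv_mul_sub_one_le_of_fineBoxPlaqs N hk U g₁ g₂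
    (cover (F.P K) '' {x : Pt (F.P K).d | blockMap ((F.P K).L ^ j) x = y + fun _ => ((ctrShift (F.P K).L (k - j) : ℕ) : ℤ)})
    hax₁ hax₂ hN ha₀ hU (towerBoxes_of_subset_aligned le_rfl hk hyY hY hYΩ) a ha hbud hgd haa h100 hguard hθ0 hθ hωτ0 hωu0 hω hθω hE hjk y
    (cover_anchor_mem_image_of_underZ hjk y (fun _ hx => hx)) h u hu hh hptu hu1

end Summit.QuantumFields.YangMills.BalabanUVNodes.N07SymTauCellRowOfFinePlaquettes

end
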